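import Summits.QuantumFields.GaugeBoot.StrongCouplingWords
import Summits.QuantumFields.GaugeBoot.WordUpdate
import HarnessLib

/-!
# Strong coupling from the loop equation: the private links of the plaquette words through an edge (gauge-boot, ADDENDUM 24 part C)

HONEST FRAMING (cell `pub-gaugeboot`, page 1 of every file): the venture produces certified bounds
on lattice expectations at stated coupling, gauge group, dimension and torus size; NOT a mass gap,
NOT a continuum limit, NOT a string tension; NOT Yang–Mills-summit-bearing (barriers
`FixedCouplingUltralocality`, `PerturbativeInvisibility`).  Pure lattice-word combinatorics on the torus
`(ℤ/L)^d`, `L ≥ 2`: no measure, no number.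

## Content

The third loop-equation step for the plaquette `P̃₀ = +μ +ν₀ −μ −ν₀` (read from `x`; ADDENDUM 24) marks, in the
deformed words `P̃₀ · q^{±1}` (`q = P̃_{ν,ε} = plaqWord μ ν ε` another plaquette word through `(x, μ)`), a link that is
read EXACTLY ONCE and is read by none of the spectators.  Two links of `q` serve:

* `qEdge x μ ν ε` — the link read by the SECOND letter of `q` (`(x+e_μ, ν)` resp. `(x+e_μ−e_ν, ν)`);
* `qEdge' x μ ν ε` — the link read by the THIRD letter of `q` (`(x+e_ν, μ)` resp. `(x−e_ν, μ)`).

Proved (all `[folklore]`, hypotheses `μ ≠ ν₀`, `ν ≠ μ`, `(ν, ε) ≠ (ν₀, +)`, `L ≥ 2`): the edge lists of `P̃_{ν,ε}^{±1}`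
(`edgesRead_plaqWord_false`, `…_reverse`); each of `qEdge`, `qEdge'` is read exactly once by `q` and by `q⁻¹`
(`count_qEdge_eq_one`, `count_qEdge'_eq_one`); `qEdge` is read by none of `P̃₀^{±1}` and the re-based
`+ν₀ −μ −ν₀ +μ` at `x + e_μ` and its reverse (`qEdge_not_mem_…`), and by no plaquette word `plaqWord ν₀ ν' ε'^{±1}`
through `(x+e_μ, ν₀)` other than the one with `(ν', ε') = (ν, ε)` (`qEdge_not_mem_plaqWord₂`); `qEdge'` (for
`ν ≠ ν₀`) is read by none of the `P̃₀`-words and by no `plaqWord ν₀ ν' ε'^{±1}` with `ν' ≠ μ`.  The read-once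
counts of the composite words `P̃₀ · q^{±1}` and `(+ν₀ −μ −ν₀ · q^{±1} · +μ) · Q^{±1}` follow in
`StrongCouplingThirdOrderWords.lean`.
-/

noncomputable section

open Literature.MathematicalPhysics.QuantumFieldTheory

namespace Summit.QuantumFields.GaugeBoot

namespace StrongCoupling

variable {d L : ℕ}

/-! ## Small helpers -/

/-- Edges with different axes differ. [folklore] -/
theorem edge_ne_of_snd_ne {a b : Site d L} {i j : Fin d} (h : i ≠ j) : ((a, i) : Edge d L) ≠ (b, j) :=
  fun e => h (Prod.ext_iff.1 e).2

/-- Edges with different sources differ. [folklore] -/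
theorem edge_ne_of_fst_ne {a b : Site d L} {i j : Fin d} (h : a ≠ b) : ((a, i) : Edge d L) ≠ (b, j) :=
  fun e => h (Prod.ext_iff.1 e).1

/-- Non-membership in a four-element list. [folklore] -/
theorem not_mem_four {α : Type*} {e a b c f : α} (h₁ : e ≠ a) (h₂ : e ≠ b) (h₃ : e ≠ c) (h₄ : e ≠ f) :
    e ∉ [a, b, c, f] := by
  simp [h₁, h₂, h₃, h₄]

/-- The count of the second element of a four-element list, the others being different from it. [folklore] -/
theorem count_second_eq_one {α : Type*} [BEq α] [LawfulBEq α] {e a c f : α} (h₁ : a ≠ e) (h₃ : c ≠ e)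
    (h₄ : f ≠ e) : [a, e, c, f].count e = 1 := by
  simp [h₁, h₃, h₄]

/-- The count of the third element of a four-element list, the others being different from it. [folklore] -/
theorem count_third_eq_one {α : Type*} [BEq α] [LawfulBEq α] {e a b f : α} (h₁ : a ≠ e) (h₂ : b ≠ e)
    (h₄ : f ≠ e) : [a, b, e, f].count e = 1 := by
  simp [h₁, h₂, h₄]

/-! ## The private links and the edge lists -/

/-- The link read by the SECOND letter of `P̃_{ν,ε} = plaqWord μ ν ε` read from `x`: `(x + e_μ, ν)` for `ε = +`,
`(x + e_μ − e_ν, ν)` for `ε = −`. [folklore] -/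
def qEdge (x : Site d L) (μ ν : Fin d) : Bool → Edge d L
  | true => (x.shift μ, ν)
  | false => (x.shift μ - Pi.single ν 1, ν)

/-- The link read by the THIRD letter of `P̃_{ν,ε}` read from `x`: `(x + e_ν, μ)` for `ε = +`, `(x − e_ν, μ)` for
`ε = −`. [folklore] -/
def qEdge' (x : Site d L) (μ ν : Fin d) : Bool → Edge d L
  | true => (x.shift ν, μ)
  | false => (x - Pi.single ν 1, μ)

/-- Unfolding lemma `qEdge_true`. [folklore] -/
@[simp] theorem qEdge_true (x : Site d L) (μ ν : Fin d) : qEdge x μ ν true = (x.shift μ, ν) := rfl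
/-- Unfolding lemma `qEdge_false`. [folklore] -/
@[simp] theorem qEdge_false (x : Site d L) (μ ν : Fin d) : qEdge x μ ν false = (x.shift μ - Pi.single ν 1, ν) := rfl
/-- Unfolding lemma `qEdge'_true`. [folklore] -/
@[simp] theorem qEdge'_true (x : Site d L) (μ ν : Fin d) : qEdge' x μ ν true = (x.shift ν, μ) := rfl
/-- Unfolding lemma `qEdge'_false`. [folklore] -/
@[simp] theorem qEdge'_false (x : Site d L) (μ ν : Fin d) : qEdge' x μ ν false = (x - Pi.single ν 1, μ) := rfl

/-- Edges of `P̃_{ν,+} = +μ +ν −μ −ν` read from `x`. [folklore] -/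
theorem edgesRead_plaqWord_true (x : Site d L) (μ ν : Fin d) :
    Word.edgesRead x (plaqWord μ ν true) = [(x, μ), (x.shift μ, ν), (x.shift ν, μ), (x, ν)] := by
  rw [plaqWord_true]; exact Word.edgesRead_plaquette x μ ν

/-- Edges of `P̃_{ν,−} = +μ −ν −μ +ν` read from `x`. [folklore] -/
theorem edgesRead_plaqWord_false (x : Site d L) (μ ν : Fin d) :
    Word.edgesRead x (plaqWord μ ν false) =
      [(x, μ), (x.shift μ - Pi.single ν 1, ν), (x - Pi.single ν 1, μ), (x - Pi.single ν 1, ν)] := by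
  have h1 : x.shift μ - Pi.single ν 1 - Pi.single μ 1 = x - Pi.single ν 1 := by simp only [Site.shift]; abel
  simp [plaqWord, Word.edgesRead, Step.edge, Step.apply, h1]

/-- Edges of `P̃_{ν,+}⁻¹ = +ν +μ −ν −μ` read from `x`. [folklore] -/
theorem edgesRead_plaqWord_true_reverse (x : Site d L) (μ ν : Fin d) :
    Word.edgesRead x (plaqWord μ ν true).reverse = [(x, ν), (x.shift ν, μ), (x.shift μ, ν), (x, μ)] := by
  rw [plaqWord_true_reverse]
  have h1 : (x.shift ν).shift μ - Pi.single ν 1 = x.shift μ := by simp only [Site.shift]; abel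
  have h2 : x.shift μ - Pi.single μ 1 = x := by simp [Site.shift]
  simp [Word.edgesRead, Step.edge, Step.apply, h1, h2]

/-- Edges of `P̃_{ν,−}⁻¹ = −ν +μ +ν −μ` read from `x`. [folklore] -/
theorem edgesRead_plaqWord_false_reverse (x : Site d L) (μ ν : Fin d) :
    Word.edgesRead x (plaqWord μ ν false).reverse =
      [(x - Pi.single ν 1, ν), (x - Pi.single ν 1, μ), (x.shift μ - Pi.single ν 1, ν), (x, μ)] := by
  rw [plaqWord_false_reverse]
  have h1 : (x - Pi.single ν 1).shift μ = x.shift μ - Pi.single ν 1 := by simp only [Site.shift]; abel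
  have h2 : (x.shift μ - Pi.single ν 1).shift ν = x.shift μ := by simp only [Site.shift]; abel
  have h3 : x.shift μ - Pi.single μ 1 = x := by simp [Site.shift]
  simp [Word.edgesRead, Step.edge, Step.apply, h1, h2, h3]

/-! ## `qEdge` and `qEdge'` are read once by `q` and by `q⁻¹` -/

section Counts

/-- `x + e_μ − e_ν' ≠ x − e_ν'` (`L ≥ 2`). [folklore] -/
theorem shift_sub_ne (hL : (1 : ZMod L) ≠ 0) (x : Site d L) (μ ν' : Fin d) :
    x.shift μ - Pi.single ν' 1 ≠ x - Pi.single ν' 1 := by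
  intro h
  have h' := congrFun h μ
  simp [Site.shift] at h'
  exact hL h'

/-- **`qEdge` is read exactly once by `q = P̃_{ν,ε}` and by `q⁻¹`.** [folklore] -/
theorem count_qEdge_eq_one [NeZero L] (hL : (1 : ZMod L) ≠ 0) (x : Site d L) {μ ν : Fin d} (hνμ : ν ≠ μ) (ε : Bool)
    {w : Word d} (hw : w = plaqWord μ ν ε ∨ w = (plaqWord μ ν ε).reverse) :
    (Word.edgesRead x w).count (qEdge x μ ν ε) = 1 := by
  have hμν : μ ≠ ν := fun h => hνμ h.symm
  have hyx : x.shift μ ≠ x := shift_ne_self hL x μ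
  rcases hw with rfl | rfl <;> cases ε
  · rw [edgesRead_plaqWord_false, qEdge_false]
    exact count_second_eq_one (edge_ne_of_snd_ne hμν) (edge_ne_of_snd_ne hμν)
      (edge_ne_of_fst_ne (shift_sub_ne hL x μ ν).symm)
  · rw [edgesRead_plaqWord_true, qEdge_true]
    exact count_second_eq_one (edge_ne_of_snd_ne hμν) (edge_ne_of_snd_ne hμν) (edge_ne_of_fst_ne hyx.symm)
  · rw [edgesRead_plaqWord_false_reverse, qEdge_false]
    exact count_third_eq_one (edge_ne_of_fst_ne (shift_sub_ne hL x μ ν).symm) (edge_ne_of_snd_ne hμν)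
      (edge_ne_of_snd_ne hμν)
  · rw [edgesRead_plaqWord_true_reverse, qEdge_true]
    exact count_third_eq_one (edge_ne_of_fst_ne hyx.symm) (edge_ne_of_snd_ne hμν) (edge_ne_of_snd_ne hμν)

/-- **`qEdge'` is read exactly once by `q` and by `q⁻¹`.** [folklore] -/
theorem count_qEdge'_eq_one [NeZero L] (hL : (1 : ZMod L) ≠ 0) (x : Site d L) {μ ν : Fin d} (hνμ : ν ≠ μ) (ε : Bool)
    {w : Word d} (hw : w = plaqWord μ ν ε ∨ w = (plaqWord μ ν ε).reverse) :
    (Word.edgesRead x w).count (qEdge' x μ ν ε) = 1 := by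
  have hx1 : x ≠ x.shift ν := (shift_ne_self hL x ν).symm
  have hx2 : x ≠ x - Pi.single ν 1 := (Equipartition.sub_single_ne_self hL x ν).symm
  rcases hw with rfl | rfl <;> cases ε
  · rw [edgesRead_plaqWord_false, qEdge'_false]
    exact count_third_eq_one (edge_ne_of_fst_ne hx2) (edge_ne_of_snd_ne hνμ) (edge_ne_of_snd_ne hνμ)
  · rw [edgesRead_plaqWord_true, qEdge'_true]
    exact count_third_eq_one (edge_ne_of_fst_ne hx1) (edge_ne_of_snd_ne hνμ) (edge_ne_of_snd_ne hνμ)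
  · rw [edgesRead_plaqWord_false_reverse, qEdge'_false]
    exact count_second_eq_one (edge_ne_of_snd_ne hνμ) (edge_ne_of_snd_ne hνμ) (edge_ne_of_fst_ne hx2)
  · rw [edgesRead_plaqWord_true_reverse, qEdge'_true]
    exact count_second_eq_one (edge_ne_of_snd_ne hνμ) (edge_ne_of_snd_ne hνμ) (edge_ne_of_fst_ne hx1)

end Counts

/-! ## The `P̃₀`-words do not read `qEdge`, `qEdge'` -/

section PlaquetteZero

variable [NeZero L]

/-- `qEdge` differs from each of the four links of the plaquette `P̃₀` (`(ν, ε) ≠ (ν₀, +)`). [folklore] -/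
theorem qEdge_ne_four (hL : (1 : ZMod L) ≠ 0) (x : Site d L) {μ ν₀ ν : Fin d} (hμν₀ : μ ≠ ν₀) (hνμ : ν ≠ μ)
    {ε : Bool} (hne : ¬(ν = ν₀ ∧ ε = true)) :
    qEdge x μ ν ε ≠ (x, μ) ∧ qEdge x μ ν ε ≠ (x.shift μ, ν₀) ∧ qEdge x μ ν ε ≠ (x.shift ν₀, μ) ∧
      qEdge x μ ν ε ≠ (x, ν₀) := by
  cases ε with
  | true =>
    have hνν₀ : ν ≠ ν₀ := fun h => hne ⟨h, rfl⟩
    rw [qEdge_true]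
    exact ⟨edge_ne_of_snd_ne hνμ, edge_ne_of_snd_ne hνν₀, edge_ne_of_snd_ne hνμ, edge_ne_of_snd_ne hνν₀⟩
  | false =>
    rw [qEdge_false]
    refine ⟨edge_ne_of_snd_ne hνμ, ?_, edge_ne_of_snd_ne hνμ, ?_⟩
    · by_cases hνν₀ : ν = ν₀
      · subst hνν₀
        exact edge_ne_of_fst_ne (Equipartition.sub_single_ne_self hL _ ν)
      · exact edge_ne_of_snd_ne hνν₀
    · by_cases hνν₀ : ν = ν₀
      · subst hνν₀
        refine edge_ne_of_fst_ne (site_ne_of_apply_ne μ ?_)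
        simp only [Site.shift, Pi.add_apply, Pi.sub_apply, Pi.single_eq_same, Pi.single_eq_of_ne hμν₀]
        exact zmod_ne_of_sub_eq_one hL (by ring)
      · exact edge_ne_of_snd_ne hνν₀

/-- `qEdge'` differs from each of the four links of `P̃₀` (here `ν ≠ ν₀`). [folklore] -/
theorem qEdge'_ne_four (hL : (1 : ZMod L) ≠ 0) (x : Site d L) {μ ν₀ ν : Fin d} (hμν₀ : μ ≠ ν₀) (ε : Bool)
    (hνν₀ : ν ≠ ν₀) :
    qEdge' x μ ν ε ≠ (x, μ) ∧ qEdge' x μ ν ε ≠ (x.shift μ, ν₀) ∧ qEdge' x μ ν ε ≠ (x.shift ν₀, μ) ∧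
      qEdge' x μ ν ε ≠ (x, ν₀) := by
  cases ε with
  | true =>
    rw [qEdge'_true]
    refine ⟨edge_ne_of_fst_ne (shift_ne_self hL x ν), edge_ne_of_snd_ne hμν₀, ?_, edge_ne_of_snd_ne hμν₀⟩
    refine edge_ne_of_fst_ne (site_ne_of_apply_ne ν ?_)
    simp only [Site.shift, Pi.add_apply, Pi.single_eq_same, Pi.single_eq_of_ne hνν₀]
    exact zmod_ne_of_sub_eq_one hL (by ring)
  | false =>
    rw [qEdge'_false]
    refine ⟨edge_ne_of_fst_ne (Equipartition.sub_single_ne_self hL x ν), edge_ne_of_snd_ne hμν₀, ?_, edge_ne_of_snd_ne hμν₀⟩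
    refine edge_ne_of_fst_ne (site_ne_of_apply_ne ν ?_)
    simp only [Site.shift, Pi.add_apply, Pi.sub_apply, Pi.single_eq_same, Pi.single_eq_of_ne hνν₀]
    exact zmod_ne_of_sub_eq_neg_one hL (by ring)

omit [NeZero L] in
/-- The four `P̃₀`-words read only the four links of `P̃₀`: membership criterion. [folklore] -/
theorem not_mem_plaqWordZero_of_ne_four (x : Site d L) {μ ν₀ : Fin d} {e : Edge d L}
    (h : e ≠ (x, μ) ∧ e ≠ (x.shift μ, ν₀) ∧ e ≠ (x.shift ν₀, μ) ∧ e ≠ (x, ν₀)) :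
    e ∉ Word.edgesRead x (plaqWord μ ν₀ true) ∧ e ∉ Word.edgesRead x (plaqWord μ ν₀ true).reverse ∧
      e ∉ Word.edgesRead (x.shift μ) (plaqWord ν₀ μ false) ∧
      e ∉ Word.edgesRead (x.shift μ) (plaqWord ν₀ μ false).reverse := by
  obtain ⟨h1, h2, h3, h4⟩ := h
  have e1 : x.shift μ - Pi.single μ 1 = x := by simp [Site.shift]
  have e2 : (x.shift μ).shift ν₀ - Pi.single μ 1 = x.shift ν₀ := by simp only [Site.shift]; abel
  refine ⟨?_, ?_, ?_, ?_⟩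
  · rw [edgesRead_plaqWord_true]; exact not_mem_four h1 h2 h3 h4
  · rw [edgesRead_plaqWord_true_reverse]; exact not_mem_four h4 h3 h2 h1
  · rw [edgesRead_plaqWord_false, e1, e2]; exact not_mem_four h2 h3 h4 h1
  · rw [edgesRead_plaqWord_false_reverse, e1, e2]; exact not_mem_four h1 h4 h3 h2

/-- ★ **`qEdge` is read by none of the `P̃₀`-words** `P̃₀`, `P̃₀⁻¹` (read from `x`), `+ν₀ −μ −ν₀ +μ` and its reverse
(read from `x + e_μ`), for `(ν, ε) ≠ (ν₀, +)`. [folklore] -/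
theorem qEdge_not_mem_plaqWordZero (hL : (1 : ZMod L) ≠ 0) (x : Site d L) {μ ν₀ ν : Fin d} (hμν₀ : μ ≠ ν₀)
    (hνμ : ν ≠ μ) {ε : Bool} (hne : ¬(ν = ν₀ ∧ ε = true)) :
    qEdge x μ ν ε ∉ Word.edgesRead x (plaqWord μ ν₀ true) ∧
      qEdge x μ ν ε ∉ Word.edgesRead x (plaqWord μ ν₀ true).reverse ∧
      qEdge x μ ν ε ∉ Word.edgesRead (x.shift μ) (plaqWord ν₀ μ false) ∧
      qEdge x μ ν ε ∉ Word.edgesRead (x.shift μ) (plaqWord ν₀ μ false).reverse :=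
  not_mem_plaqWordZero_of_ne_four x (qEdge_ne_four hL x hμν₀ hνμ hne)

/-- ★ **`qEdge'` is read by none of the `P̃₀`-words** (`ν ≠ ν₀`). [folklore] -/
theorem qEdge'_not_mem_plaqWordZero (hL : (1 : ZMod L) ≠ 0) (x : Site d L) {μ ν₀ ν : Fin d} (hμν₀ : μ ≠ ν₀)
    (ε : Bool) (hνν₀ : ν ≠ ν₀) :
    qEdge' x μ ν ε ∉ Word.edgesRead x (plaqWord μ ν₀ true) ∧
      qEdge' x μ ν ε ∉ Word.edgesRead x (plaqWord μ ν₀ true).reverse ∧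
      qEdge' x μ ν ε ∉ Word.edgesRead (x.shift μ) (plaqWord ν₀ μ false) ∧
      qEdge' x μ ν ε ∉ Word.edgesRead (x.shift μ) (plaqWord ν₀ μ false).reverse :=
  not_mem_plaqWordZero_of_ne_four x (qEdge'_ne_four hL x hμν₀ ε hνν₀)

/-! ## The plaquette words through `(x + e_μ, ν₀)` -/

/-- ★ **`qEdge` is read by no plaquette word `plaqWord ν₀ ν' ε'^{±1}` through `(x + e_μ, ν₀)` other than the one with
`(ν', ε') = (ν, ε)`** (`ν' ≠ ν₀`, `(ν, ε) ≠ (ν₀, +)`). [folklore] -/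
theorem qEdge_not_mem_plaqWord₂ (hL : (1 : ZMod L) ≠ 0) (x : Site d L) {μ ν₀ ν : Fin d} (hνμ : ν ≠ μ)
    {ε : Bool} (hne : ¬(ν = ν₀ ∧ ε = true)) {ν' : Fin d} (hν'ν₀ : ν' ≠ ν₀) {ε' : Bool}
    (hne' : ¬(ν' = ν ∧ ε' = ε)) {Q : Word d} (hQ : Q = plaqWord ν₀ ν' ε' ∨ Q = (plaqWord ν₀ ν' ε').reverse) :
    qEdge x μ ν ε ∉ Word.edgesRead (x.shift μ) Q := by
  -- the four links of `Q`
  have key : qEdge x μ ν ε ∉ Word.edgesRead (x.shift μ) (plaqWord ν₀ ν' ε') := by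
    cases ε with
    | true =>
      have hνν₀ : ν ≠ ν₀ := fun h => hne ⟨h, rfl⟩
      rw [qEdge_true]
      cases ε' with
      | true =>
        have hν'ν : ν' ≠ ν := fun h => hne' ⟨h, rfl⟩
        rw [edgesRead_plaqWord_true]
        exact not_mem_four (edge_ne_of_snd_ne hνν₀) (edge_ne_of_snd_ne (Ne.symm hν'ν)) (edge_ne_of_snd_ne hνν₀)
          (edge_ne_of_snd_ne (Ne.symm hν'ν))
      | false =>
        rw [edgesRead_plaqWord_false]
        refine not_mem_four (edge_ne_of_snd_ne hνν₀) ?_ (edge_ne_of_snd_ne hνν₀) ?_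
        · by_cases hν'ν : ν' = ν
          · subst hν'ν
            refine edge_ne_of_fst_ne (site_ne_of_apply_ne ν₀ ?_)
            simp only [Site.shift, Pi.add_apply, Pi.sub_apply, Pi.single_eq_same, Pi.single_eq_of_ne hνν₀.symm]
            exact zmod_ne_of_sub_eq_neg_one hL (by ring)
          · exact edge_ne_of_snd_ne (Ne.symm hν'ν)
        · by_cases hν'ν : ν' = ν
          · subst hν'ν
            exact edge_ne_of_fst_ne (Equipartition.sub_single_ne_self hL (x.shift μ) ν').symm
          · exact edge_ne_of_snd_ne (Ne.symm hν'ν)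
    | false =>
      rw [qEdge_false]
      cases ε' with
      | true =>
        rw [edgesRead_plaqWord_true]
        refine not_mem_four ?_ ?_ ?_ ?_
        · by_cases hνν₀ : ν = ν₀
          · subst hνν₀; exact edge_ne_of_fst_ne (Equipartition.sub_single_ne_self hL (x.shift μ) ν)
          · exact edge_ne_of_snd_ne hνν₀
        · by_cases hν'ν : ν' = ν
          · subst hν'ν
            refine edge_ne_of_fst_ne (site_ne_of_apply_ne ν' ?_)
            simp only [Site.shift, Pi.add_apply, Pi.sub_apply, Pi.single_eq_same, Pi.single_eq_of_ne hν'ν₀]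
            exact zmod_ne_of_sub_eq_neg_one hL (by ring)
          · exact edge_ne_of_snd_ne (Ne.symm hν'ν)
        · by_cases hνν₀ : ν = ν₀
          · subst hνν₀
            refine edge_ne_of_fst_ne (site_ne_of_apply_ne ν ?_)
            simp only [Site.shift, Pi.add_apply, Pi.sub_apply, Pi.single_eq_same, Pi.single_eq_of_ne hν'ν₀.symm]
            exact zmod_ne_of_sub_eq_neg_one hL (by ring)
          · exact edge_ne_of_snd_ne hνν₀
        · by_cases hν'ν : ν' = ν
          · subst hν'ν; exact edge_ne_of_fst_ne (Equipartition.sub_single_ne_self hL (x.shift μ) ν')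
          · exact edge_ne_of_snd_ne (Ne.symm hν'ν)
      | false =>
        have hν'ν : ν' ≠ ν := fun h => hne' ⟨h, rfl⟩
        rw [edgesRead_plaqWord_false]
        refine not_mem_four ?_ (edge_ne_of_snd_ne (Ne.symm hν'ν)) ?_ (edge_ne_of_snd_ne (Ne.symm hν'ν))
        · by_cases hνν₀ : ν = ν₀
          · subst hνν₀; exact edge_ne_of_fst_ne (Equipartition.sub_single_ne_self hL (x.shift μ) ν)
          · exact edge_ne_of_snd_ne hνν₀
        · by_cases hνν₀ : ν = ν₀
          · subst hνν₀
            refine edge_ne_of_fst_ne (site_ne_of_apply_ne ν ?_)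
            simp only [Site.shift, Pi.add_apply, Pi.sub_apply, Pi.single_eq_same, Pi.single_eq_of_ne hν'ν₀.symm]
            exact zmod_ne_of_sub_eq_neg_one hL (by ring)
          · exact edge_ne_of_snd_ne hνν₀
  rcases hQ with rfl | rfl
  · exact key
  · -- the reversed word reads the same four links
    intro hmem
    apply key
    cases ε' with
    | true =>
      rw [edgesRead_plaqWord_true_reverse] at hmem
      rw [edgesRead_plaqWord_true]
      simp only [List.mem_cons, List.not_mem_nil, or_false] at hmem ⊢
      tauto
    | false =>
      rw [edgesRead_plaqWord_false_reverse] at hmem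
      rw [edgesRead_plaqWord_false]
      simp only [List.mem_cons, List.not_mem_nil, or_false] at hmem ⊢
      tauto

omit [NeZero L] in
/-- ★ **`qEdge'` is read by no plaquette word `plaqWord ν₀ ν' ε'^{±1}` through `(x + e_μ, ν₀)` with `ν' ≠ μ`** (axes
`ν₀, ν' ≠ μ`). [folklore] -/
theorem qEdge'_not_mem_plaqWord₂ (x : Site d L) {μ ν₀ ν : Fin d} (hμν₀ : μ ≠ ν₀) (ε : Bool) {ν' : Fin d} (hν'μ : ν' ≠ μ)
    (ε' : Bool) {Q : Word d}
    (hQ : Q = plaqWord ν₀ ν' ε' ∨ Q = (plaqWord ν₀ ν' ε').reverse) :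
    qEdge' x μ ν ε ∉ Word.edgesRead (x.shift μ) Q := by
  have hax : ∀ (a : Site d L) (κ : Fin d), κ ≠ μ → ∀ b : Site d L, qEdge' x μ ν ε ≠ (b, κ) := by
    intro a κ hκ b
    cases ε
    · rw [qEdge'_false]; exact edge_ne_of_snd_ne (Ne.symm hκ)
    · rw [qEdge'_true]; exact edge_ne_of_snd_ne (Ne.symm hκ)
  have h0 := hax x ν₀ (Ne.symm hμν₀)
  have h1 := hax x ν' hν'μ
  rcases hQ with rfl | rfl <;> cases ε'
  · rw [edgesRead_plaqWord_false]; exact not_mem_four (h0 _) (h1 _) (h0 _) (h1 _)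
  · rw [edgesRead_plaqWord_true]; exact not_mem_four (h0 _) (h1 _) (h0 _) (h1 _)
  · rw [edgesRead_plaqWord_false_reverse]; exact not_mem_four (h1 _) (h0 _) (h1 _) (h0 _)
  · rw [edgesRead_plaqWord_true_reverse]; exact not_mem_four (h1 _) (h0 _) (h1 _) (h0 _)

end PlaquetteZero

end StrongCoupling

end Summit.QuantumFields.GaugeBoot

end
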